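import Summits.NavierStokesRegularity.NavierStokesRegularity.Theorems.TerminalTraceTypeITraceScarL3ApexPackageTranslate
import Summits.NavierStokesRegularity.NavierStokesRegularity.Theorems.TerminalTraceTypeITraceScarL3LoudDustUniformlyPerfect
import Summits.NavierStokesRegularity.NavierStokesRegularity.Theorems.TerminalTraceTypeITraceScarL3RegularPointExtinction
import Summits.NavierStokesRegularity.NavierStokesRegularity.Theorems.TerminalTraceTypeITraceScarL3TopSingularNull
import Literature.Geometry.GeometricMeasureTheory.ContentCover
import Literature.Analysis.FluidPDE.LocalTypeI
import HarnessLib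

/-!
# STRONG EXTINCTION of an extinct Type-I apex: the local energy vanishes at the top time
# (item `TerminalTrace.TypeITraceScarL3`, stmt-NavierStokesRegularity-18385; ROUND-26 §1e L26-1 / §3a (S4);
# ns-typeII-p3 g9's STRONG-EXTINCTION sketch, now a theorem)

Seat ns-typeII-p3 g10 (cell ns-regularity-ideate), `--supports stmt-NavierStokesRegularity-18385` (helper).
For the apex package of line `annulus-dichotomy` — `(U, P)` suitable in every parabolic ball `Q(a)` at the
space–time origin, Albritton–Barker bound `𝐈(Q(a)) ≤ M`, plain pressure bound `D(z₀, r) ≤ D₀` at apices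
`z₀.1 ≤ 0`, weakly null top trace (the weak gradient `G` only enters through `𝐈`; the rate is not used) —
the WEAK extinction at the top upgrades to STRONG local extinction:

  `strongExtinction`: for every radius `R` and `η > 0` there is `s₀ < 0` with
  `∫_{B(0,R)} ‖U(s)‖² ≤ η` for a.e. `s ∈ ]s₀, 0[`.

Proof (no Frostman, no Arzelà–Ascoli):
* the top singular set `Σ₀` is closed (`isClosed_topSingularSet`) and `ℋ¹`-null
  (`hausdorffMeasure_topSingular_apex_eq_zero`, CKN Theorem B at the top slice), so the compact
  `K = Σ₀ ∩ B̄(0,R)` has finite ball covers with `Σ ρₙ` as small as we please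
  (`exists_finset_ball_cover_of_hausdorffMeasure_lt`, Federer 2.10.2);
* A-MORREY ABOUT EVERY CENTRE (`ae_lintegral_ball_le_of_typeIBound`): `𝐈(Q(a)) ≤ M` for all `a` bounds
  `ess sup_t ρ⁻¹∫_{B(x,ρ)}|U(t)|²` for every ball, so the cover carries energy `≤ M Σ ρₙ` at a.e. late time;
* the rest `B̄(0,R) ∖ ⋃ B(xₙ, ρₙ)` is compact and backward regular, hence covered by finitely many balls on
  each of which the energy is eventually (a.e.) small (`localEnergy_le_near_top_of_not_isBackwardSingularPoint`,
  the regular half: ESS representative with Lipschitz slices up to the top + weak nullity on finitely many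
  bumps).

Consequence for the line (ROUND-26 §3a (S4), §3c): the local energy `E_ρ(s) → 0` of every extinct Type-I
apex, so the extinction exponent `β(U) = liminf log E_ρ(s)/log(−s) ≥ 0` of a loud survivor is a genuine
number of the class.  WHAT THIS IS NOT: not Stub C / QA / LOUD, not NS regularity, no RATE of extinction.
[folklore; CaffarelliKohnNirenberg1982 Thm B; EscauriazaSereginSverak2003 §3; Federer1969 2.10.2]
-/

noncomputable section

set_option linter.dupNamespace false

namespace Summit.NavierStokesRegularity.NavierStokesRegularity.Theorems.TypeITraceScarL3

open MeasureTheory Set Function Filter Topology Metric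
open Literature.Analysis.FluidPDE
open scoped NNReal ENNReal InnerProductSpace RealInnerProductSpace

/-! ### Finite unions and the Lebesgue integral -/

/-- Subadditivity of the lower Lebesgue integral over a finite union. [folklore] -/
theorem lintegral_biUnion_finset_le {ι α : Type*} [MeasurableSpace α] (μ : Measure α) (S : Finset ι)
    (s : ι → Set α) (f : α → ℝ≥0∞) :
    ∫⁻ a in ⋃ i ∈ S, s i, f a ∂μ ≤ ∑ i ∈ S, ∫⁻ a in s i, f a ∂μ := by
  classical
  induction S using Finset.induction_on with
  | empty => simp
  | insert i S hi ih =>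
    rw [Finset.set_biUnion_insert, Finset.sum_insert hi]
    exact (lintegral_union_le _ _ _).trans (add_le_add le_rfl ih)

/-! ### A-Morrey about every centre -/

/-- **The A-part of `𝐈` about every centre at the top**: if `𝐈(Q(a)) ≤ M` for every `a > 0` then for every
ball `B(x, ρ)`, `ρ > 0`, and a.e. `t ∈ ]−ρ², 0[`: `∫_{B(x,ρ)} |U(t)|² ≤ M ρ` (`Q_ρ((0,x)) ⊆ Q_{ρ+|x|}(0)`,
`A_ess ≤ A + C + D + E ≤ 𝐈`). [cite: AlbrittonBarker2019, §1 (display defining 𝐈(ω) after Thm 1.1)] -/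
theorem ae_lintegral_ball_le_of_typeIBound
    {U : ℝ → EuclideanSpace ℝ (Fin 3) → EuclideanSpace ℝ (Fin 3)}
    {P : ℝ → EuclideanSpace ℝ (Fin 3) → ℝ}
    {G : ℝ → EuclideanSpace ℝ (Fin 3) → EuclideanSpace ℝ (Fin 3) →L[ℝ] EuclideanSpace ℝ (Fin 3)}
    {M : ℝ≥0}
    (hI : ∀ a : ℝ, 0 < a →
      typeIBound (parabolicCylinder a (0 : ℝ × EuclideanSpace ℝ (Fin 3))) U P G ≤ M)
    (x : EuclideanSpace ℝ (Fin 3)) {ρ : ℝ} (hρ : 0 < ρ) :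
    ∀ᵐ t ∂(volume.restrict (Ioo (-ρ ^ 2) 0)),
      ∫⁻ z in ball x ρ, ‖U t z‖ₑ ^ 2 ≤ (M : ℝ≥0∞) * ENNReal.ofReal ρ := by
  have hax : 0 < ρ + ‖x‖ := add_pos_of_pos_of_nonneg hρ (norm_nonneg x)
  have hA : cknAEss ρ (((0 : ℝ), x) : ℝ × EuclideanSpace ℝ (Fin 3)) U ≤ M := by
    have h1 : abScaledSum ρ (((0 : ℝ), x) : ℝ × EuclideanSpace ℝ (Fin 3)) U P G ≤ M :=
      (abScaledSum_le_typeIBound hρ (parabolicCylinder_top_subset_zero x hρ)).trans (hI _ hax)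
    refine le_trans ?_ h1
    unfold abScaledSum
    exact le_add_right (le_add_right (le_add_right le_rfl))
  unfold cknAEss at hA
  simp only [zero_sub] at hA
  have hne0 : ENNReal.ofReal ρ ≠ 0 := (ENNReal.ofReal_pos.2 hρ).ne'
  have hnetop : ENNReal.ofReal ρ ≠ ⊤ := ENNReal.ofReal_ne_top
  filter_upwards [ENNReal.ae_le_essSup (μ := volume.restrict (Ioo (-ρ ^ 2) 0))
    (fun t : ℝ => (ENNReal.ofReal ρ)⁻¹ * ∫⁻ z in ball x ρ, ‖U t z‖ₑ ^ 2)] with t ht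
  have h1 : (ENNReal.ofReal ρ)⁻¹ * ∫⁻ z in ball x ρ, ‖U t z‖ₑ ^ 2 ≤ M := ht.trans hA
  calc ∫⁻ z in ball x ρ, ‖U t z‖ₑ ^ 2
      = ENNReal.ofReal ρ * ((ENNReal.ofReal ρ)⁻¹ * ∫⁻ z in ball x ρ, ‖U t z‖ₑ ^ 2) := by
        rw [← mul_assoc, ENNReal.mul_inv_cancel hne0 hnetop, one_mul]
    _ ≤ ENNReal.ofReal ρ * M := mul_le_mul' le_rfl h1
    _ = (M : ℝ≥0∞) * ENNReal.ofReal ρ := mul_comm _ _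

/-! ### Finitely many late-time conditions hold simultaneously -/

/-- If each of finitely many a.e.-in-late-time conditions holds on some interval `]s_i, 0[`, then all of
them hold a.e. on a common interval `]s₀, 0[`. [folklore] -/
theorem exists_neg_ae_restrict_forall_finset {ι : Type*} (I : Finset ι) {p : ι → ℝ → Prop}
    (h : ∀ i ∈ I, ∃ s₀ : ℝ, s₀ < 0 ∧ ∀ᵐ s ∂(volume.restrict (Ioo s₀ 0)), p i s) :
    ∃ s₀ : ℝ, s₀ < 0 ∧ ∀ᵐ s ∂(volume.restrict (Ioo s₀ 0)), ∀ i ∈ I, p i s := by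
  classical
  induction I using Finset.induction_on with
  | empty => exact ⟨-1, by norm_num, ae_of_all _ fun _ _ hi => by simp at hi⟩
  | insert j I hj ih =>
    obtain ⟨s₁, hs₁, h₁⟩ := h j (Finset.mem_insert_self _ _)
    obtain ⟨s₂, hs₂, h₂⟩ := ih fun i hi => h i (Finset.mem_insert_of_mem hi)
    refine ⟨max s₁ s₂, max_lt hs₁ hs₂, ?_⟩
    filter_upwards [ae_restrict_of_ae_restrict_of_subset (Ioo_subset_Ioo_left (le_max_left _ _)) h₁,
      ae_restrict_of_ae_restrict_of_subset (Ioo_subset_Ioo_left (le_max_right _ _)) h₂] with s hs1 hs2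
    intro i hi
    rcases Finset.mem_insert.1 hi with rfl | hi
    · exact hs1
    · exact hs2 i hi

/-! ### The singular cover: small energy near the top singular set -/

/-- **Energy near the top singular dust is small**: for `R, ε > 0` the compact `ℋ¹`-null set
`Σ₀ ∩ B̄(0,R)` (`Σ₀` = top singular set) is covered by finitely many balls `B(xₙ, ρₙ)`, `ρₙ > 0`, with
`M Σₙ ρₙ ≤ ε` (Federer 2.10.2 + CKN Theorem B at the top slice); by A-Morrey about every centre the cover
then carries energy `≤ ε` at a.e. late time. [cite: Federer1969, 2.10.2] -/
theorem exists_cover_topSingular_sum_le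
    {U : ℝ → EuclideanSpace ℝ (Fin 3) → EuclideanSpace ℝ (Fin 3)}
    {P : ℝ → EuclideanSpace ℝ (Fin 3) → ℝ}
    (hsw : ∀ a : ℝ, 0 < a →
      IsSuitableWeakSolutionInBall a (0 : ℝ × EuclideanSpace ℝ (Fin 3)) U P)
    (M : ℝ≥0) (R : ℝ) {ε : ℝ} (hε : 0 < ε) :
    ∃ (S : Finset ℕ) (x : ℕ → EuclideanSpace ℝ (Fin 3)) (ρ : ℕ → ℝ), (∀ n ∈ S, 0 < ρ n) ∧
      {x : EuclideanSpace ℝ (Fin 3) | IsBackwardSingularPoint U ((0 : ℝ), x)} ∩ closedBall 0 R ⊆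
        ⋃ n ∈ S, ball (x n) (ρ n) ∧
      (M : ℝ≥0∞) * ∑ n ∈ S, ENNReal.ofReal (ρ n) ≤ ENNReal.ofReal ε := by
  have hKc : IsCompact ({x : EuclideanSpace ℝ (Fin 3) | IsBackwardSingularPoint U ((0 : ℝ), x)} ∩
      closedBall 0 R) :=
    (isCompact_closedBall (0 : EuclideanSpace ℝ (Fin 3)) R).of_isClosed_subset
      ((isClosed_topSingularSet U).inter isClosed_closedBall) inter_subset_right
  have hK0 : μH[1] ({x : EuclideanSpace ℝ (Fin 3) | IsBackwardSingularPoint U ((0 : ℝ), x)} ∩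
      closedBall 0 R) = 0 :=
    measure_mono_null inter_subset_left (hausdorffMeasure_topSingular_apex_eq_zero hsw)
  have hMpos : 0 < (M : ℝ) + 1 := by positivity
  have hγpos : 0 < ENNReal.ofReal (ε / (16 * ((M : ℝ) + 1))) := by
    rw [ENNReal.ofReal_pos]; positivity
  have hγlt : μH[1] ({x : EuclideanSpace ℝ (Fin 3) | IsBackwardSingularPoint U ((0 : ℝ), x)} ∩
      closedBall 0 R) < ENNReal.ofReal (ε / (16 * ((M : ℝ) + 1))) := by rw [hK0]; exact hγpos
  obtain ⟨S, x, ρ, hρ, hKcov, hsum⟩ :=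
    Literature.Geometry.GeometricMeasureTheory.exists_finset_ball_cover_of_hausdorffMeasure_lt
      one_pos hKc hγlt ENNReal.ofReal_ne_top one_pos
  refine ⟨S, x, ρ, fun n hn => (hρ n hn).1, hKcov, ?_⟩
  have h4 : (2 : ℝ≥0∞) ^ ((1 : ℝ) + 1) = 4 := by
    rw [show ((1 : ℝ) + 1) = ((2 : ℕ) : ℝ) by norm_num, ENNReal.rpow_natCast]; norm_num
  have hsum' : ∑ n ∈ S, ENNReal.ofReal (ρ n) ≤ 8 * ENNReal.ofReal (ε / (16 * ((M : ℝ) + 1))) := by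
    have h1 : ∑ n ∈ S, ENNReal.ofReal (ρ n) = ∑ n ∈ S, ENNReal.ofReal (ρ n) ^ (1 : ℝ) := by
      simp only [ENNReal.rpow_one]
    rw [h1]
    refine hsum.trans (le_of_eq ?_)
    rw [h4, ← mul_assoc]
    norm_num
  calc (M : ℝ≥0∞) * ∑ n ∈ S, ENNReal.ofReal (ρ n)
      ≤ (M : ℝ≥0∞) * (8 * ENNReal.ofReal (ε / (16 * ((M : ℝ) + 1)))) := mul_le_mul' le_rfl hsum'
    _ = ENNReal.ofReal ((M : ℝ) * (8 * (ε / (16 * ((M : ℝ) + 1))))) := by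
        rw [← ENNReal.ofReal_ofNat 8, ← ENNReal.ofReal_mul (by norm_num),
          ENNReal.ofReal_coe_nnreal.symm, ← ENNReal.ofReal_mul (NNReal.coe_nonneg M)]
    _ ≤ ENNReal.ofReal ε := by
        refine ENNReal.ofReal_le_ofReal ?_
        have hle : (M : ℝ) / ((M : ℝ) + 1) ≤ 1 := by
          rw [div_le_one hMpos]; linarith
        rw [show (M : ℝ) * (8 * (ε / (16 * ((M : ℝ) + 1)))) = ((M : ℝ) * ε) / (2 * ((M : ℝ) + 1)) by
          field_simp; ring]
        rw [div_le_iff₀ (by positivity)]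
        nlinarith [NNReal.coe_nonneg M, hε, hle]

/-! ### Strong extinction -/

/-- **STRONG EXTINCTION of an extinct Type-I apex** (ROUND-26 L26-1; ns-typeII-p3 g9's sketch).  If `(U, P)`
is suitable in every parabolic ball `Q(a)` at the origin, with `𝐈(Q(a)) ≤ M` for all `a`, plain pressure
bound `D(z₀, r) ≤ D₀` at apices `z₀.1 ≤ 0`, and weakly null top trace, then for every `R > 0` and `η > 0`
(indeed every `R`) there is `s₀ < 0` such that `∫_{B(0,R)} ‖U(s)‖² ≤ η` for a.e. `s ∈ ]s₀, 0[`.  Proof: cover the compact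
`ℋ¹`-null set `Σ₀ ∩ B̄(0,R)` by finitely many balls with `M Σ ρₙ ≤ η/2` (Federer + CKN at the top), bound
their energy by A-Morrey about every centre, cover the compact regular remainder by finitely many balls of
eventual energy `≤ η/(2(N+1))` each (regular half), and take the latest of the finitely many times.
[folklore; CaffarelliKohnNirenberg1982 Thm B; Federer1969 2.10.2; EscauriazaSereginSverak2003 §3] -/
theorem strongExtinction
    {U : ℝ → EuclideanSpace ℝ (Fin 3) → EuclideanSpace ℝ (Fin 3)}
    {P : ℝ → EuclideanSpace ℝ (Fin 3) → ℝ}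
    {G : ℝ → EuclideanSpace ℝ (Fin 3) → EuclideanSpace ℝ (Fin 3) →L[ℝ] EuclideanSpace ℝ (Fin 3)}
    {M D₀ : ℝ≥0}
    (hsw : ∀ a : ℝ, 0 < a →
      IsSuitableWeakSolutionInBall a (0 : ℝ × EuclideanSpace ℝ (Fin 3)) U P)
    (hI : ∀ a : ℝ, 0 < a →
      typeIBound (parabolicCylinder a (0 : ℝ × EuclideanSpace ℝ (Fin 3))) U P G ≤ M)
    (hD : ∀ z₀ : ℝ × EuclideanSpace ℝ (Fin 3), z₀.1 ≤ 0 →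
      ∀ r : ℝ, 0 < r → cknD r z₀ P ≤ D₀)
    (htop : ∀ φ : EuclideanSpace ℝ (Fin 3) → EuclideanSpace ℝ (Fin 3),
      ContDiff ℝ (⊤ : ℕ∞) φ →
      HasCompactSupport φ → ∀ ε : ℝ, 0 < ε →
      ∃ s₀ : ℝ, s₀ < 0 ∧ ∀ᵐ s ∂(volume.restrict (Ioo s₀ 0)), |∫ y, ⟪U s y, φ y⟫| ≤ ε)
    (R : ℝ) {η : ℝ} (hη : 0 < η) :
    ∃ s₀ : ℝ, s₀ < 0 ∧ ∀ᵐ s ∂(volume.restrict (Ioo s₀ 0)),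
      ∫⁻ z in ball (0 : EuclideanSpace ℝ (Fin 3)) R, ‖U s z‖ₑ ^ 2 ≤ ENNReal.ofReal η := by
  classical
  -- ### the singular cover with `M Σ ρₙ ≤ η/2`
  obtain ⟨S, x, ρ, hρ, hKcov, hcoverE⟩ := exists_cover_topSingular_sum_le hsw M R (half_pos hη)
  -- its energy at a.e. late time
  obtain ⟨s₁, hs₁, hMorrey⟩ : ∃ s₁ : ℝ, s₁ < 0 ∧ ∀ᵐ s ∂(volume.restrict (Ioo s₁ 0)), ∀ n ∈ S,
      ∫⁻ z in ball (x n) (ρ n), ‖U s z‖ₑ ^ 2 ≤ (M : ℝ≥0∞) * ENNReal.ofReal (ρ n) :=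
    exists_neg_ae_restrict_forall_finset S fun n hn =>
      ⟨-(ρ n) ^ 2, neg_lt_zero.2 (pow_pos (hρ n hn) 2),
        ae_lintegral_ball_le_of_typeIBound hI (x n) (hρ n hn)⟩
  -- ### the compact regular remainder and its finite cover by regular balls
  have hOo : IsOpen (⋃ n ∈ S, ball (x n) (ρ n)) := isOpen_biUnion fun _ _ => isOpen_ball
  have hK'c : IsCompact (closedBall (0 : EuclideanSpace ℝ (Fin 3)) R \ ⋃ n ∈ S, ball (x n) (ρ n)) :=
    (isCompact_closedBall _ _).diff hOo
  have hreg : ∀ y ∈ closedBall (0 : EuclideanSpace ℝ (Fin 3)) R \ ⋃ n ∈ S, ball (x n) (ρ n),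
      ∃ r : ℝ, 0 < r ∧ ∀ θ : ℝ, 0 < θ → ∃ s₀ : ℝ, s₀ < 0 ∧
        ∀ᵐ s ∂(volume.restrict (Ioo s₀ 0)),
          ∫⁻ z in ball y r, ‖U s z‖ₑ ^ 2 ≤ ENNReal.ofReal θ := by
    rintro y ⟨hyR, hyO⟩
    refine localEnergy_le_near_top_of_not_isBackwardSingularPoint hsw hD htop fun hsing => ?_
    exact hyO (hKcov ⟨hsing, hyR⟩)
  choose! rr hrr hθy using hreg
  obtain ⟨T, hTsub, hTcov⟩ : ∃ T : Finset (EuclideanSpace ℝ (Fin 3)),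
      (↑T : Set (EuclideanSpace ℝ (Fin 3))) ⊆
        closedBall (0 : EuclideanSpace ℝ (Fin 3)) R \ ⋃ n ∈ S, ball (x n) (ρ n) ∧
      closedBall (0 : EuclideanSpace ℝ (Fin 3)) R \ ⋃ n ∈ S, ball (x n) (ρ n) ⊆
        ⋃ y ∈ T, ball y (rr y) := by
    obtain ⟨b', hb'sub, hb'fin, hb'cov⟩ := hK'c.elim_finite_subcover_image
      (b := closedBall (0 : EuclideanSpace ℝ (Fin 3)) R \ ⋃ n ∈ S, ball (x n) (ρ n))
      (c := fun y => ball y (rr y)) (fun _ _ => isOpen_ball)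
      (fun y hy => mem_biUnion hy (mem_ball_self (hrr y hy)))
    refine ⟨hb'fin.toFinset, by rwa [Set.Finite.coe_toFinset], ?_⟩
    simpa only [Set.Finite.mem_toFinset] using hb'cov
  -- the tolerance per regular ball and the common late time of the regular cover
  have hθ₁pos : 0 < η / (2 * ((T.card : ℝ) + 1)) := by positivity
  obtain ⟨s₂, hs₂, hRegular⟩ : ∃ s₂ : ℝ, s₂ < 0 ∧ ∀ᵐ s ∂(volume.restrict (Ioo s₂ 0)), ∀ y ∈ T,
      ∫⁻ z in ball y (rr y), ‖U s z‖ₑ ^ 2 ≤ ENNReal.ofReal (η / (2 * ((T.card : ℝ) + 1))) :=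
    exists_neg_ae_restrict_forall_finset T fun y hy => hθy y (hTsub hy) _ hθ₁pos
  refine ⟨max s₁ s₂, max_lt hs₁ hs₂, ?_⟩
  filter_upwards [ae_restrict_of_ae_restrict_of_subset (Ioo_subset_Ioo_left (le_max_left _ _)) hMorrey,
    ae_restrict_of_ae_restrict_of_subset (Ioo_subset_Ioo_left (le_max_right _ _)) hRegular]
    with s hsM hsT
  -- ### assemble
  have hballsub : ball (0 : EuclideanSpace ℝ (Fin 3)) R ⊆
      (⋃ n ∈ S, ball (x n) (ρ n)) ∪ ⋃ y ∈ T, ball y (rr y) := by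
    intro z hz
    by_cases hzO : z ∈ ⋃ n ∈ S, ball (x n) (ρ n)
    · exact Or.inl hzO
    · exact Or.inr (hTcov ⟨ball_subset_closedBall hz, hzO⟩)
  have hcard : (T.card : ℝ≥0∞) * ENNReal.ofReal (η / (2 * ((T.card : ℝ) + 1))) ≤
      ENNReal.ofReal (η / 2) := by
    rw [← ENNReal.ofReal_natCast, ← ENNReal.ofReal_mul (Nat.cast_nonneg _)]
    refine ENNReal.ofReal_le_ofReal ?_
    have h2 : 0 < 2 * ((T.card : ℝ) + 1) := by positivity
    rw [← mul_div_assoc, div_le_iff₀ h2]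
    nlinarith [hη, Nat.cast_nonneg (α := ℝ) T.card]
  calc ∫⁻ z in ball (0 : EuclideanSpace ℝ (Fin 3)) R, ‖U s z‖ₑ ^ 2
      ≤ ∫⁻ z in (⋃ n ∈ S, ball (x n) (ρ n)) ∪ ⋃ y ∈ T, ball y (rr y), ‖U s z‖ₑ ^ 2 :=
        lintegral_mono_set hballsub
    _ ≤ (∫⁻ z in ⋃ n ∈ S, ball (x n) (ρ n), ‖U s z‖ₑ ^ 2) +
          ∫⁻ z in ⋃ y ∈ T, ball y (rr y), ‖U s z‖ₑ ^ 2 := lintegral_union_le _ _ _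
    _ ≤ (∑ n ∈ S, ∫⁻ z in ball (x n) (ρ n), ‖U s z‖ₑ ^ 2) +
          ∑ y ∈ T, ∫⁻ z in ball y (rr y), ‖U s z‖ₑ ^ 2 :=
        add_le_add (lintegral_biUnion_finset_le _ _ _ _) (lintegral_biUnion_finset_le _ _ _ _)
    _ ≤ (∑ n ∈ S, (M : ℝ≥0∞) * ENNReal.ofReal (ρ n)) +
          ∑ _y ∈ T, ENNReal.ofReal (η / (2 * ((T.card : ℝ) + 1))) :=
        add_le_add (Finset.sum_le_sum hsM) (Finset.sum_le_sum hsT)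
    _ = (M : ℝ≥0∞) * ∑ n ∈ S, ENNReal.ofReal (ρ n) +
          (T.card : ℝ≥0∞) * ENNReal.ofReal (η / (2 * ((T.card : ℝ) + 1))) := by
        rw [Finset.mul_sum, Finset.sum_const, nsmul_eq_mul]
    _ ≤ ENNReal.ofReal (η / 2) + ENNReal.ofReal (η / 2) := add_le_add hcoverE hcard
    _ = ENNReal.ofReal η := by
        rw [← ENNReal.ofReal_add (by positivity) (by positivity), add_halves]

end Summit.NavierStokesRegularity.NavierStokesRegularity.Theorems.TypeITraceScarL3

end
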